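import Literature.RingTheory.CohomologyAnnihilator.Basic
import Literature.AlgebraicGeometry.Resolution.LocalBlowup
import Mathlib.RingTheory.Adjoin.FG
import Mathlib.RingTheory.Localization.FractionRing
import HarnessLib

/-!
# Route HomologicalConductor — crux `Globalisation` (stmt-ResolutionOfSingularities-16486): tower models

Line `birth_HomologicalConductor` (reshaped, "lu-patching cut"), stub `stub_towerModel`.

Along a valuation ring `O` of `K ⊇ k`, the canonical tower of a finitely generated affine model
`A ⊆ O` of `K` is `T₀ = loc A`, `T_(m+1) = loc (nrm (chart T_m))`, where for a `k`-subalgebra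
`B ⊆ K`: `loc B` is `B` localised at the centre of `O` (read inside `K`), `chart B` is the blow-up
chart of the cohomology-annihilator ideal `ca B` at a generator of minimal `O`-value, and `nrm B`
is the `k`-subalgebra generated by the `B`-integral elements of `K`.  Given the three one-step
facts as hypotheses (`h₁`: `loc B = locAtCentre B O`; `h₂`: the chart set lies in the local ring of
a finitely generated enlargement `D[t]`; `h₃`: the integral elements lie in the local ring of a
finitely generated enlargement `D'`), every stage `T_m` is `locAtCentre A_m O` for a finitely
generated model `A ≤ A_m ⊆ O` — a plain induction on `m` (`towerModel_aux`, with the tower's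
ingredients abstracted as functions plus defining equations, so that the route's `let`-telescope
is discharged by `rfl`s and `Subalgebra.image_coe_cohomologyAnnihilator`).
-/

-- single-problem summit: the doubled namespace component `ResolutionOfSingularities` is forced
set_option linter.dupNamespace false

namespace Summit.ResolutionOfSingularities.ResolutionOfSingularities.Theorems.HomologicalConductorGlobalisation

open Literature.AlgebraicGeometry.Resolution

section Aux

variable {k K : Type} [Field k] [Field K] [Algebra k K]

/-- `Algebra.adjoin k S` lies in every subring of `K` containing `k` and `S`. [folklore] -/
private theorem towerModel_adjoin_toSubring_le {S : Set K} {T : Subring K}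
    (hkT : ∀ c : k, algebraMap k K c ∈ T) (hS : S ⊆ T) : (Algebra.adjoin k S).toSubring ≤ T := by
  -- adapted from `risoGlob_adjoin_le_subring` (Theorems/RisoStrataRisoGlobalisationCentres.lean)
  intro z hz
  replace hz : z ∈ Algebra.adjoin k S := hz
  induction hz using Algebra.adjoin_induction with
  | mem x hx => exact hS hx
  | algebraMap c => exact hkT c
  | add x y _ _ hx hy => exact add_mem hx hy
  | mul x y _ _ hx hy => exact mul_mem hx hy

/-- A subalgebra containing an affine model of `K` is again a model of `K`. [folklore] -/
private theorem towerModel_isFractionRing_of_le {A A' : Subalgebra k K} (hle : A ≤ A')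
    (hA : IsFractionRing ↥A K) : IsFractionRing ↥A' K := by
  -- adapted from `Literature.AlgebraicGeometry.Resolution.isFractionRing_of_le`
  refine IsFractionRing.of_field (↥A') K fun z => ?_
  obtain ⟨a, b, -, rfl⟩ := IsFractionRing.div_surjective (A := ↥A) z
  exact ⟨⟨a, hle a.2⟩, ⟨b, hle b.2⟩, rfl⟩

/-- Adjoining finitely many elements to a finitely generated subalgebra keeps it finitely
generated. [folklore] -/
private theorem towerModel_fg_adjoin_union {D : Subalgebra k K} (hD : D.FG) (t : Finset K) :
    (Algebra.adjoin k ((D : Set K) ∪ ↑t)).FG := by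
  rw [Algebra.adjoin_union, Algebra.adjoin_eq]
  exact hD.sup (Subalgebra.fg_adjoin_finset t)

/-- The induction behind `stub_towerModel`, with the tower's ingredients abstracted: if every
`loc B` (`B ⊆ O`) is `locAtCentre B O` (`hloc`), chart sets (`h₂`) and integral elements (`h₃`)
lie in the local rings at the centre of `O` of finitely generated enlargements, then every stage
`T m` of a tower `T 0 = loc A`, `T (m + 1) = loc (nrm (chart (T m)))` is `locAtCentre A_m O` for a
finitely generated `A ≤ A_m ⊆ O`. [cite: ZariskiSamuel1960, Ch. VI §17] -/
private theorem towerModel_aux (O : ValuationSubring K) (ca : Subalgebra k K → Set K)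
    (loc chart nrm : Subalgebra k K → Subalgebra k K) (T : ℕ → Subalgebra k K)
    (A : Subalgebra k K)
    (hca : ∀ B : Subalgebra k K, ∃ I : Ideal ↥B, ca B = ((↑) : ↥B → K) '' (I : Set ↥B))
    (hloc : ∀ B : Subalgebra k K, B.toSubring ≤ O.toSubring →
      (loc B).toSubring = locAtCentre B.toSubring O)
    (hchart : ∀ B : Subalgebra k K, chart B = Algebra.adjoin k ((B : Set K) ∪
      {y : K | ∃ c ∈ ca B, ∃ x ∈ ca B, x ≠ 0 ∧ (∀ c' ∈ ca B, c' * x⁻¹ ∈ O) ∧ y = c * x⁻¹}))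
    (hnrm : ∀ B : Subalgebra k K, nrm B = Algebra.adjoin k {y : K | IsIntegral ↥B y})
    (hT0 : T 0 = loc A) (hT : ∀ n : ℕ, T (n + 1) = loc (nrm (chart (T n))))
    (h₂ : ∀ D : Subalgebra k K, D.FG → D.toSubring ≤ O.toSubring → ∀ B : Subalgebra k K,
      B.toSubring = locAtCentre D.toSubring O → ∀ I : Ideal ↥B, ∃ t : Finset K,
        (↑t : Set K) ⊆ {y : K | ∃ c ∈ (((↑) : ↥B → K) '' (I : Set ↥B)),
          ∃ x ∈ (((↑) : ↥B → K) '' (I : Set ↥B)), x ≠ 0 ∧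
            (∀ c' ∈ (((↑) : ↥B → K) '' (I : Set ↥B)), c' * x⁻¹ ∈ O) ∧ y = c * x⁻¹} ∧
        {y : K | ∃ c ∈ (((↑) : ↥B → K) '' (I : Set ↥B)),
          ∃ x ∈ (((↑) : ↥B → K) '' (I : Set ↥B)), x ≠ 0 ∧
            (∀ c' ∈ (((↑) : ↥B → K) '' (I : Set ↥B)), c' * x⁻¹ ∈ O) ∧ y = c * x⁻¹} ⊆
          (locAtCentre (Algebra.adjoin k ((D : Set K) ∪ ↑t)).toSubring O : Set K))
    (h₃ : ∀ D : Subalgebra k K, D.FG → IsFractionRing ↥D K → D.toSubring ≤ O.toSubring →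
      ∀ C : Subalgebra k K, D ≤ C → C.toSubring ≤ locAtCentre D.toSubring O →
        ∃ D' : Subalgebra k K, D'.FG ∧ D ≤ D' ∧ D'.toSubring ≤ O.toSubring ∧
          (D' : Set K) ⊆ {y : K | IsIntegral ↥C y} ∧
          {y : K | IsIntegral ↥C y} ⊆ (locAtCentre D'.toSubring O : Set K))
    (hA : A.FG) (hAK : IsFractionRing ↥A K) (hAO : A.toSubring ≤ O.toSubring) (m : ℕ) :
    ∃ Am : Subalgebra k K, Am.FG ∧ A ≤ Am ∧ Am.toSubring ≤ O.toSubring ∧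
      (T m).toSubring = locAtCentre Am.toSubring O := by
  induction m with
  | zero => exact ⟨A, hA, le_rfl, hAO, by rw [hT0]; exact hloc A hAO⟩
  | succ n ih =>
    obtain ⟨Am, hAmfg, hAAm, hAmO, hB⟩ := ih
    rw [hT n]
    -- the stage-`n` algebra `B = locAtCentre Am O`, read in `K`
    generalize T n = B at hB ⊢
    have hAmB : Am ≤ B := fun x hx => by
      have h := le_locAtCentre Am.toSubring O hx
      rw [← hB] at h
      exact h
    -- `ca B` is (the image of) an ideal `I` of `B`; finitely many chart generators `t`
    obtain ⟨I, hI⟩ := hca B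
    obtain ⟨t, ht, hchartset⟩ := h₂ Am hAmfg hAmO B hB I
    -- the enlarged finitely generated model `D = Am[t] ⊆ O`
    set D : Subalgebra k K := Algebra.adjoin k ((Am : Set K) ∪ ↑t) with hDdef
    have hDfg : D.FG := towerModel_fg_adjoin_union hAmfg t
    have hAmD : Am ≤ D := fun x hx => Algebra.subset_adjoin (Set.mem_union_left _ hx)
    have hAD : A ≤ D := hAAm.trans hAmD
    have hDK : IsFractionRing ↥D K := towerModel_isFractionRing_of_le hAD hAK
    have htO : (↑t : Set K) ⊆ O.toSubring := by
      intro y hy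
      obtain ⟨c, hc, x, -, -, hxO, rfl⟩ := ht hy
      exact hxO c hc
    have hDO : D.toSubring ≤ O.toSubring :=
      towerModel_adjoin_toSubring_le (fun c => hAmO (Am.algebraMap_mem c))
        (Set.union_subset (fun x hx => hAmO hx) htO)
    -- the chart `C = chart B`: `D ≤ C` and `C ⊆ locAtCentre D O`
    have hC := hchart B
    rw [hI] at hC
    have hDC : D ≤ chart B := by
      rw [hC]
      refine Algebra.adjoin_le (Set.union_subset (fun x hx => ?_) (fun y hy => ?_))
      · exact Algebra.subset_adjoin (Set.mem_union_left _ (hAmB hx))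
      · exact Algebra.subset_adjoin (Set.mem_union_right _ (ht hy))
    have hCloc : (chart B).toSubring ≤ locAtCentre D.toSubring O := by
      rw [hC]
      refine towerModel_adjoin_toSubring_le (fun c => le_locAtCentre _ O (D.algebraMap_mem c))
        (Set.union_subset (fun x hx => ?_) hchartset)
      have hx' : x ∈ locAtCentre Am.toSubring O := by
        rw [← hB]
        exact hx
      exact locAtCentre_mono O (fun y hy => hAmD hy) hx'
    -- the normalisation step: a finitely generated `D ≤ D' ⊆ O` of `C`-integral elements
    obtain ⟨D', hD'fg, hDD', hD'O, hD'int, hintD'⟩ := h₃ D hDfg hDK hDO (chart B) hDC hCloc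
    have hN := hnrm (chart B)
    have hD'N : D' ≤ nrm (chart B) := fun x hx => by
      rw [hN]
      exact Algebra.subset_adjoin (hD'int hx)
    have hNloc : (nrm (chart B)).toSubring ≤ locAtCentre D'.toSubring O := by
      rw [hN]
      exact towerModel_adjoin_toSubring_le (fun c => le_locAtCentre _ O (D'.algebraMap_mem c))
        hintD'
    have hNO : (nrm (chart B)).toSubring ≤ O.toSubring := hNloc.trans (locAtCentre_le hD'O)
    -- stage `n + 1 = loc (nrm (chart B)) = locAtCentre (nrm (chart B)) O = locAtCentre D' O`
    refine ⟨D', hD'fg, hAD.trans hDD', hD'O, ?_⟩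
    rw [hloc _ hNO]
    refine le_antisymm ?_ (locAtCentre_mono O fun x hx => hD'N hx)
    calc locAtCentre (nrm (chart B)).toSubring O
        ≤ locAtCentre (locAtCentre D'.toSubring O) O := locAtCentre_mono O hNloc
      _ = locAtCentre D'.toSubring O := locAtCentre_locAtCentre _ O

end Aux

/-- **Tower models.** Every stage of the canonical tower
`T₀ = loc A`, `T_(m+1) = loc (nrm (chart T_m))` of a finitely generated affine model `A ⊆ O` of
`K` along a valuation ring `O` is the local ring at the centre of `O` of a finitely generated
model `A ≤ A_m ⊆ O`, granted the three one-step facts `h₁` (localisation), `h₂` (chart),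
`h₃` (normalisation). [cite: ZariskiSamuel1960, Ch. VI §17] -/
theorem stub_towerModel (h₁ : ∀ {k K : Type} [Field k] [Field K] [Algebra k K] (O : ValuationSubring K) (B : Subalgebra k K), B.toSubring ≤ O.toSubring → (Algebra.adjoin k {y : K | ∃ a ∈ B, ∃ s ∈ B, s⁻¹ ∈ O ∧ y = a * s⁻¹}).toSubring = Literature.AlgebraicGeometry.Resolution.locAtCentre B.toSubring O) (h₂ : ∀ {k K : Type} [Field k] [Field K] [Algebra k K] (O : ValuationSubring K) (D : Subalgebra k K), D.FG → D.toSubring ≤ O.toSubring → ∀ (B : Subalgebra k K), B.toSubring = Literature.AlgebraicGeometry.Resolution.locAtCentre D.toSubring O → ∀ I : Ideal ↥B, ∃ t : Finset K, (↑t : Set K) ⊆ {y : K | ∃ c ∈ (((↑) : ↥B → K) '' (I : Set ↥B)), ∃ x ∈ (((↑) : ↥B → K) '' (I : Set ↥B)), x ≠ 0 ∧ (∀ c' ∈ (((↑) : ↥B → K) '' (I : Set ↥B)), c' * x⁻¹ ∈ O) ∧ y = c * x⁻¹} ∧ {y : K | ∃ c ∈ (((↑) : ↥B → K) '' (I : Set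 ↥B)), ∃ x ∈ (((↑) : ↥B → K) '' (I : Set ↥B)), x ≠ 0 ∧ (∀ c' ∈ (((↑) : ↥B → K) '' (I : Set ↥B)), c' * x⁻¹ ∈ O) ∧ y = c * x⁻¹} ⊆ (Literature.AlgebraicGeometry.Resolution.locAtCentre (Algebra.adjoin k ((D : Set K) ∪ ↑t)).toSubring O : Set K)) (h₃ : ∀ {k K : Type} [Field k] [Field K] [Algebra k K] (O : ValuationSubring K) (D : Subalgebra k K), D.FG → IsFractionRing ↥D K → D.toSubring ≤ O.toSubring → ∀ (C : Subalgebra k K), D ≤ C → C.toSubring ≤ Literature.AlgebraicGeometry.Resolution.locAtCentre D.toSubring O → ∃ D' : Subalgebra k K, D'.FG ∧ D ≤ D' ∧ D'.toSubring ≤ O.toSubring ∧ (D' : Set K) ⊆ {y : K | IsIntegral ↥C y} ∧ {y : K | IsIntegral ↥C y} ⊆ (Literature.AlgebraicGeometry.Resolution.locAtCentre D'.toSubring O : Set K)) :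
    ∀ {k K : Type} [Field k] [Field K] [Algebra k K] (O : ValuationSubring K) (A : Subalgebra k K), A.FG → IsFractionRing ↥A K → A.toSubring ≤ O.toSubring → ∀ m : ℕ, let ca : Subalgebra k K → Set K := fun A => {x : K | ∃ hx : x ∈ A, ∃ n : ℕ, ∀ i : ℕ, n ≤ i → ∀ (M N : ModuleCat.{0} ↥A), Module.Finite ↥A M → Module.Finite ↥A N → ∀ e : CategoryTheory.Abelian.Ext.{0} M N i, (⟨x, hx⟩ : ↥A) • e = 0}; let loc : Subalgebra k K → Subalgebra k K := fun A => Algebra.adjoin k {y : K | ∃ a ∈ A, ∃ s ∈ A, s⁻¹ ∈ O ∧ y = a * s⁻¹}; let chart : Subalgebra k K → Subalgebra k K := fun A => Algebra.adjoin k ((A : Set K) ∪ {y : K | ∃ c ∈ ca A, ∃ x ∈ ca A, x ≠ 0 ∧ (∀ c' ∈ ca A, c' * x⁻¹ ∈ O) ∧ y = c * x⁻¹}); let nrm : Subalgebra k K → Subalgebra k K := fun B => Algebra.adjoin k {y : K | IsIntegral ↥B y}; let tower : Subalgebra k K → ℕ → Subalgebra k K := fun A m => @Nat.rec (fun _ =>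 Subalgebra k K) (loc A) (fun _ B => loc (nrm (chart B))) m; ∃ Am : Subalgebra k K, Am.FG ∧ A ≤ Am ∧ Am.toSubring ≤ O.toSubring ∧ (tower A m).toSubring = Literature.AlgebraicGeometry.Resolution.locAtCentre Am.toSubring O := by
  intro k K _ _ _ O A hA hAK hAO m ca loc chart nrm tower
  exact towerModel_aux O ca loc chart nrm (tower A) A
    (fun B => ⟨Literature.RingTheory.CohomologyAnnihilator.cohomologyAnnihilator ↥B,
      (Subalgebra.image_coe_cohomologyAnnihilator B).symm⟩)
    (fun B hB => h₁ O B hB) (fun _ => rfl) (fun _ => rfl) rfl (fun _ => rfl) (h₂ O) (h₃ O)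
    hA hAK hAO m

end Summit.ResolutionOfSingularities.ResolutionOfSingularities.Theorems.HomologicalConductorGlobalisation
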